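import Mathlib
import Summits.NavierStokesRegularity.NavierStokesRegularity.Theorems.FilamentSkeletonRssSkeletonJ1RFrameDefs
import Summits.NavierStokesRegularity.NavierStokesRegularity.Theorems.FilamentSkeletonRssMatchedKernelTangencyProjection
import Summits.NavierStokesRegularity.NavierStokesRegularity.Theorems.FilamentSkeletonRssClause13LinearisedMap

/-!
# Crux `SkeletonJ1R` (stmt-NavierStokesRegularity-23610) · line `streamline_kantorovich_R` · stub L-core (`CorePinningL`) — FIRST VARIATION OF THE
# SWITCHED DEFECT INSIDE THE OPEN BALL `‖x_j τ‖ < ℓ`: it is the first variation of the TRUE-FIELD tangency defect, in normal form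
# `D = (V′)_⊥ − w₀·(Y′)_⊥ − ⟪d, Y′⟫·x′` (`V′` = variation of the true field, `w₀` = true slip, `d` = the reference's defect)

Lead `ns-fsr-lead-23610` g0, 2026-08-29 (entry point of the in-ball reduction "L-red" of L-notes §8; companion of the model-region file
`…SkeletonJ1RFarPinning`).  MODEL rung, NEGATIVE side of the ladder; nothing here bears on Navier–Stokes regularity.

* `swDefect_eventuallyEq_ball` — for `‖x_j τ‖² < ℓ²` (`ℓ = Rb√(Γ log Γ) ≠ 0`) and `s` near `0`, the switched defect of `x + sY` at `(j, τ)` is the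
  tangency defect of the true field of `x + sY` (switch weight `1` on a neighbourhood);
* `swDefect_ball_hasDerivAt` — hence its `s`-derivative at `0` is `MatchedKernel.hasDerivAt_tangencyDefect`'s expression in the true-field variation `V′`
  (hypothesis `hV'`, supplied by `…SkeletonJ1RSwDefectVariation.trueField_hasDerivAt_variation`), `V₀ = trueField x (x_j τ)`, `P = x_j′ τ`, `P′ = Y_j′ τ`;
* `ball_deriv_normalForm` — for `‖P‖ = 1` that expression equals `(V′ − ⟪V′,P⟫P) − ⟪V₀,P⟫•(P′ − ⟪P,P′⟫P) − ⟪V₀ − ⟪V₀,P⟫P, P′⟫•P`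
  (pure algebra; `V₀ − ⟪V₀,P⟫P` is the reference's own switched defect at a ball point).
-/

set_option linter.dupNamespace false -- `NavierStokesRegularity.NavierStokesRegularity` path/namespace repetition is the tree convention
set_option linter.style.longLine false -- statement lines follow the registered skeleton's layout

namespace Summit.NavierStokesRegularity.NavierStokesRegularity.Theorems.SkeletonJ1RFrame

open Set Function Filter Real Topology
open scoped InnerProductSpace
open Summit.NavierStokesRegularity.NavierStokesRegularity.Theorems.MatchedKernel (deriv_add_smul_curve hasDerivAt_tangencyDefect)

variable {N : ℕ} {Γ Rb α : ℝ} {γ : Fin N → ℝ} {x Y : Fin N → ℝ → EuclideanSpace ℝ (Fin 3)}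
  {M : EuclideanSpace ℝ (Fin 3) → EuclideanSpace ℝ (Fin 3)}

/-- Inside the open ball `‖x_j τ‖² < ℓ²` (`ℓ = Rb√(Γ log Γ) ≠ 0`), for `s` near `0` the switched defect of `x + sY` at `(j, τ)` is the tangency defect of the
TRUE field of `x + sY` at the moved point, with tangent `x_j′ τ + s•Y_j′ τ`. [folklore] -/
theorem swDefect_eventuallyEq_ball (hℓ : Rb * Real.sqrt (Γ * Real.log Γ) ≠ 0) (j : Fin N) (τ : ℝ) (hxj : ContDiff ℝ 1 (x j))
    (hYj : ContDiff ℝ 1 (Y j)) (hball : ‖x j τ‖ ^ 2 < (Rb * Real.sqrt (Γ * Real.log Γ)) ^ 2) :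
    (fun s : ℝ => swDefect Γ Rb γ α M (fun k σ => x k σ + s • Y k σ) j τ) =ᶠ[𝓝 0] fun s : ℝ =>
      trueField Γ γ α (fun k σ => x k σ + s • Y k σ) (x j τ + s • Y j τ) -
        (⟪trueField Γ γ α (fun k σ => x k σ + s • Y k σ) (x j τ + s • Y j τ), deriv (x j) τ + s • deriv (Y j) τ⟫_ℝ /
            ‖deriv (x j) τ + s • deriv (Y j) τ‖ ^ 2) • (deriv (x j) τ + s • deriv (Y j) τ) := by
  have hcont : ContinuousAt (fun s : ℝ => ‖x j τ + s • Y j τ‖ ^ 2) 0 := by fun_prop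
  have h0 : ‖x j τ + (0:ℝ) • Y j τ‖ ^ 2 < (Rb * Real.sqrt (Γ * Real.log Γ)) ^ 2 := by simpa using hball
  have hev : ∀ᶠ s in 𝓝 (0:ℝ), ‖x j τ + s • Y j τ‖ ^ 2 < (Rb * Real.sqrt (Γ * Real.log Γ)) ^ 2 :=
    hcont.eventually (gt_mem_nhds h0)
  filter_upwards [hev] with s hs
  have hw : switchWeight (Rb * Real.sqrt (Γ * Real.log Γ)) 1 (x j τ + s • Y j τ) = 1 :=
    switchWeight_eq_one_of_sq_le hℓ (by linarith)
  have hd : deriv (fun σ => x j σ + s • Y j σ) τ = deriv (x j) τ + s • deriv (Y j) τ := deriv_add_smul_curve hxj hYj s τ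
  unfold swDefect switchedField
  simp only [hw, hd, one_smul, sub_self, zero_smul, add_zero]

/-- **First variation of the switched defect inside the open ball.**  With `x_j, Y_j ∈ C¹`, `x_j′ τ ≠ 0`, and `V′` the `s`-derivative at `0` of
`s ↦ trueField (x + sY) (x_j τ + s•Y_j τ)`: `d/ds|₀ swDefect(x + sY)(j, τ)` is the tangency-defect derivative in `(V₀, V′, P, P′)`,
`V₀ = trueField x (x_j τ)`, `P = x_j′ τ`, `P′ = Y_j′ τ`. [folklore] -/
theorem swDefect_ball_hasDerivAt (hℓ : Rb * Real.sqrt (Γ * Real.log Γ) ≠ 0) (j : Fin N) (τ : ℝ) (hxj : ContDiff ℝ 1 (x j))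
    (hYj : ContDiff ℝ 1 (Y j)) (hP : deriv (x j) τ ≠ 0) (hball : ‖x j τ‖ ^ 2 < (Rb * Real.sqrt (Γ * Real.log Γ)) ^ 2)
    {V' : EuclideanSpace ℝ (Fin 3)}
    (hV' : HasDerivAt (fun s : ℝ => trueField Γ γ α (fun k σ => x k σ + s • Y k σ) (x j τ + s • Y j τ)) V' 0) :
    HasDerivAt (fun s : ℝ => swDefect Γ Rb γ α M (fun k σ => x k σ + s • Y k σ) j τ)
      (V' - ((⟪trueField Γ γ α x (x j τ), deriv (x j) τ⟫_ℝ / ‖deriv (x j) τ‖ ^ 2) • deriv (Y j) τ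
        + (((⟪trueField Γ γ α x (x j τ), deriv (Y j) τ⟫_ℝ + ⟪V', deriv (x j) τ⟫_ℝ) * ‖deriv (x j) τ‖ ^ 2
            - ⟪trueField Γ γ α x (x j τ), deriv (x j) τ⟫_ℝ * (2 * ⟪deriv (x j) τ, deriv (Y j) τ⟫_ℝ)) / (‖deriv (x j) τ‖ ^ 2) ^ 2) •
          deriv (x j) τ)) 0 := by
  have hQ : HasDerivAt (fun s : ℝ => deriv (x j) τ + s • deriv (Y j) τ) (deriv (Y j) τ) 0 := by
    simpa using ((hasDerivAt_id' (x := (0:ℝ))).smul_const (deriv (Y j) τ)).const_add (deriv (x j) τ)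
  have h := hasDerivAt_tangencyDefect (W := fun s : ℝ => trueField Γ γ α (fun k σ => x k σ + s • Y k σ) (x j τ + s • Y j τ))
    (P := fun s : ℝ => deriv (x j) τ + s • deriv (Y j) τ) hV' hQ (by simpa using hP)
  refine (h.congr_of_eventuallyEq (swDefect_eventuallyEq_ball hℓ j τ hxj hYj hball)).congr_deriv ?_
  simp only [zero_smul, add_zero]

/-- **Normal form at unit speed.**  For `‖P‖ = 1` the tangency-defect derivative in `(V₀, V′, P, P′)` equals
`(V′ − ⟪V′,P⟫P) − ⟪V₀,P⟫•(P′ − ⟪P,P′⟫P) − ⟪V₀ − ⟪V₀,P⟫P, P′⟫•P`: normal part of the field variation, minus slip times the normal part of the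
tangent variation, minus a tangential term proportional to the reference's own defect `V₀ − ⟪V₀,P⟫P`. [folklore] -/
theorem ball_deriv_normalForm (V₀ V' P P' : EuclideanSpace ℝ (Fin 3)) (hP1 : ‖P‖ = 1) :
    V' - ((⟪V₀, P⟫_ℝ / ‖P‖ ^ 2) • P' + (((⟪V₀, P'⟫_ℝ + ⟪V', P⟫_ℝ) * ‖P‖ ^ 2 - ⟪V₀, P⟫_ℝ * (2 * ⟪P, P'⟫_ℝ)) / (‖P‖ ^ 2) ^ 2) • P)
      = (V' - ⟪V', P⟫_ℝ • P) - ⟪V₀, P⟫_ℝ • (P' - ⟪P, P'⟫_ℝ • P) - ⟪V₀ - ⟪V₀, P⟫_ℝ • P, P'⟫_ℝ • P := by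
  have hPP : ⟪P, P⟫_ℝ = 1 := by rw [real_inner_self_eq_norm_sq, hP1, one_pow]
  have hd : ⟪V₀ - ⟪V₀, P⟫_ℝ • P, P'⟫_ℝ = ⟪V₀, P'⟫_ℝ - ⟪V₀, P⟫_ℝ * ⟪P, P'⟫_ℝ := by
    rw [inner_sub_left, real_inner_smul_left]
  rw [hP1, hd]
  simp only [one_pow, div_one, mul_one]
  module

end Summit.NavierStokesRegularity.NavierStokesRegularity.Theorems.SkeletonJ1RFrame
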